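import Summits.QuantumFields.YangMills.Theorems.LuscherReductionOneSiteLevelsGnPullback
import Summits.QuantumFields.YangMills.Theorems.LuscherReductionOneSiteLevelsQuatPullback
import Literature.MathematicalPhysics.QuantumFieldTheory.DybalskiStottmeisterTanimoto2024.DST24CriticalPoint

/-!
# The one-link kinetic factor in the gnomonic chart
# (support module for the registered stub `stub_absLower` of crux `OneSiteLevels`, route `LuscherReduction`,
# item stmt-QuantumFields-20007; fleet seat prover ym-luscher-20007-p2)

The time-like coupling of the transfer kernel is `Re tr(U W⁻¹) = 2⟨q_U, q_W⟩` in unit-quaternion coordinates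
(`re_trace_mul_inv_eq_two_inner`).  For two chart points on the SAME hemisphere, `U = ±P(1,v)`, `W = ±P(1,v')`,

  `Re tr(U W⁻¹) = 2 − |v − v'|² + d(v,v')`,   `0 ≤ d(v,v') ≤ |v − v'|² (|v|² + |v'|²)`

(`re_trace_chart_same`, `gnDefect_nonneg`, `gnDefect_le`): the link factor `e^{B Re tr}` is the flat Gaussian `e^{2B} e^{−B|v−v'|²}`
times a correction `e^{B d} ≥ 1` which is `1 + O(B|v−v'|²(|v|²+|v'|²))` near the identity — exact algebra, the input of the
Gaussian comparison of the quasimode Rayleigh quotient.  For points on OPPOSITE hemispheres `Re tr(U W⁻¹) ≤ −2 + 2(|v|²+|v'|²)`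
(`re_trace_chart_opposite_le`), so cross-hemisphere contributions are suppressed by `e^{−(4−o(1))B}` per link.

## WHAT THIS IS NOT
Elementary algebra of unit quaternions ([folklore]); NOT the stub, NOT THE CLAY GAP.  Sorry-free, no named fact.
-/

set_option autoImplicit false

noncomputable section

open MeasureTheory Filter Topology Real
open scoped Matrix Quaternion RealInnerProductSpace
open Literature.MathematicalPhysics.QuantumFieldTheory
open Literature.MathematicalPhysics.QuantumLattice
open Literature.Analysis.OperatorTheory.YMMatrixModel
open Literature.MathematicalPhysics.QuantumFieldTheory.Balaban1983to89.T4CubeChartGnomonic (gnoPoint su2Quat_gnoPoint)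
open Literature.MathematicalPhysics.QuantumFieldTheory.Balaban1983to89.T4WilsonLinkAffine (su2Quat_inv)

namespace Summit.QuantumFields.YangMills.Theorems.FemtoTransferGap

/-! ### §1. The time-like coupling as a quaternion inner product -/

/-- **`Re tr(U W⁻¹) = 2⟨q_U, q_W⟩`** for `U, W ∈ SU(2)` with unit quaternions `q_U = su2Quat U`, `q_W = su2Quat W`. [folklore] -/
theorem re_trace_mul_inv_eq_two_inner (U W : SU2) :
    (((U * W⁻¹ : SU2) : Matrix (Fin 2) (Fin 2) ℂ).trace).re = 2 * ⟪su2Quat U, su2Quat W⟫ := by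
  rw [re_trace_eq_two_mul_scalarPart, scalarPart, su2Quat_mul, su2Quat_inv, Quaternion.inner_def]

/-- `Re tr(U W⁻¹) ≤ 2` on `SU(2)`. [folklore] -/
theorem re_trace_mul_inv_le_two (U W : SU2) : (((U * W⁻¹ : SU2) : Matrix (Fin 2) (Fin 2) ℂ).trace).re ≤ 2 := by
  rw [re_trace_eq_two_mul_scalarPart]
  have := abs_scalarPart_le (U * W⁻¹)
  linarith [le_abs_self (scalarPart (U * W⁻¹))]

/-! ### §2. Chart points on the same hemisphere: `Re tr = 2 − |v−v'|² + d` -/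

/-- Squared length, in coordinates. [folklore] -/
def vsq (v : Fin 3 → ℝ) : ℝ := ∑ i, v i ^ 2

/-- `vsq v ≥ 0`. [folklore] -/
theorem vsq_nonneg (v : Fin 3 → ℝ) : 0 ≤ vsq v := Finset.sum_nonneg fun _ _ => sq_nonneg _

/-- `‖(1,v)‖² = 1 + vsq v`. [folklore] -/
theorem norm_gnomonicQuat_sq (v : Fin 3 → ℝ) : ‖gnomonicQuat v‖ ^ 2 = 1 + vsq v := sq_norm_gnomonicQuat v

/-- `1 ≤ ‖(1,v)‖`. [folklore] -/
theorem one_le_norm_gnomonicQuat (v : Fin 3 → ℝ) : 1 ≤ ‖gnomonicQuat v‖ := by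
  have h := norm_gnomonicQuat_sq v
  have h0 : 0 ≤ ‖gnomonicQuat v‖ := norm_nonneg _
  nlinarith [vsq_nonneg v]

/-- The inner product of two gnomonic quaternions: `⟨(1,v),(1,v')⟩ = 1 + Σ vᵢ v'ᵢ`. [folklore] -/
theorem inner_gnomonicQuat (v v' : Fin 3 → ℝ) : ⟪gnomonicQuat v, gnomonicQuat v'⟫ = 1 + ∑ i, v i * v' i := by
  rw [DybalskiStottmeisterTanimoto2024.DST24CriticalPoint.inner_eq_components, Fin.sum_univ_three]
  simp [Literature.MathematicalPhysics.QuantumLattice.gnomonicQuat]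
  ring

/-- **The gnomonic defect** `d(v,v') := |v−v'|² − 2 + 2(1 + v·v')/(‖(1,v)‖‖(1,v')‖)`, so that
`2⟨P(1,v), P(1,v')⟩ = 2 − |v − v'|² + d(v,v')`. [folklore] -/
def gnDefect (v v' : Fin 3 → ℝ) : ℝ :=
  vsq (v - v') - 2 + 2 * (1 + ∑ i, v i * v' i) / (‖gnomonicQuat v‖ * ‖gnomonicQuat v'‖)

/-- `2⟨q, q'⟩ = 2 − |v−v'|² + d(v,v')` for the unit quaternions of two chart points `P(1,v)`, `P(1,v')`. [folklore] -/
theorem two_inner_su2Quat_gnoPoint (v v' : Fin 3 → ℝ) :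
    2 * ⟪su2Quat (gnoPoint v), su2Quat (gnoPoint v')⟫ = 2 - vsq (v - v') + gnDefect v v' := by
  rw [su2Quat_gnoPoint, su2Quat_gnoPoint, real_inner_smul_left, real_inner_smul_right, inner_gnomonicQuat, gnDefect]
  have hp : ‖gnomonicQuat v‖ ≠ 0 := by linarith [one_le_norm_gnomonicQuat v] |> fun h => ne_of_gt h
  have hq : ‖gnomonicQuat v'‖ ≠ 0 := by linarith [one_le_norm_gnomonicQuat v'] |> fun h => ne_of_gt h
  field_simp
  ring

/-- **`Re tr(U W⁻¹) = 2 − |v−v'|² + d(v,v')`** for chart points on the SAME hemisphere, `U = hemi b · P(1,v)`,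
`W = hemi b · P(1,v')`. [folklore] -/
theorem re_trace_chart_same (b : Bool) (v v' : Fin 3 → ℝ) :
    (((hemi b * gnoPoint v * (hemi b * gnoPoint v')⁻¹ : SU2) : Matrix (Fin 2) (Fin 2) ℂ).trace).re =
      2 - vsq (v - v') + gnDefect v v' := by
  rw [re_trace_mul_inv_eq_two_inner, ← two_inner_su2Quat_gnoPoint]
  rcases hemi_eq b with h | h
  · rw [h, one_mul, one_mul]
  · rw [h, su2Quat_mul, su2Quat_mul, su2Quat_negOne, neg_one_mul, neg_one_mul, inner_neg_left, inner_neg_right, neg_neg]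

/-- **`Re tr(U W⁻¹) = −(2 − |v−v'|² + d(v,v'))`** for chart points on OPPOSITE hemispheres. [folklore] -/
theorem re_trace_chart_opposite {b b' : Bool} (hbb : b ≠ b') (v v' : Fin 3 → ℝ) :
    (((hemi b * gnoPoint v * (hemi b' * gnoPoint v')⁻¹ : SU2) : Matrix (Fin 2) (Fin 2) ℂ).trace).re =
      -(2 - vsq (v - v') + gnDefect v v') := by
  rw [re_trace_mul_inv_eq_two_inner, ← two_inner_su2Quat_gnoPoint]
  have key : ⟪su2Quat (hemi b * gnoPoint v), su2Quat (hemi b' * gnoPoint v')⟫ =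
      -⟪su2Quat (gnoPoint v), su2Quat (gnoPoint v')⟫ := by
    cases b <;> cases b' <;> simp_all [hemi, su2Quat_mul, su2Quat_negOne, inner_neg_left, inner_neg_right]
  rw [key]
  ring

/-! ### §3. Bounds on the defect: `0 ≤ d ≤ |v−v'|²(|v|²+|v'|²)` -/

/-- Geometric decomposition of the defect: with `p = ‖(1,v)‖`, `q = ‖(1,v')‖`,
`d = |v−v'|²(1 − 1/(pq)) + (p − q)²/(pq)`. [folklore] -/
theorem gnDefect_eq (v v' : Fin 3 → ℝ) :
    gnDefect v v' = vsq (v - v') * (1 - 1 / (‖gnomonicQuat v‖ * ‖gnomonicQuat v'‖)) +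
      (‖gnomonicQuat v‖ - ‖gnomonicQuat v'‖) ^ 2 / (‖gnomonicQuat v‖ * ‖gnomonicQuat v'‖) := by
  have hp1 := one_le_norm_gnomonicQuat v
  have hq1 := one_le_norm_gnomonicQuat v'
  have hp2 := norm_gnomonicQuat_sq v
  have hq2 := norm_gnomonicQuat_sq v'
  have hvsq : vsq (v - v') = vsq v + vsq v' - 2 * ∑ i, v i * v' i := by
    simp only [vsq, Pi.sub_apply, Finset.mul_sum, ← Finset.sum_add_distrib, ← Finset.sum_sub_distrib]
    exact Finset.sum_congr rfl fun i _ => by ring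
  unfold gnDefect
  have hpq : ‖gnomonicQuat v‖ * ‖gnomonicQuat v'‖ ≠ 0 := by positivity
  field_simp
  nlinarith [hp2, hq2, hvsq]

/-- **`0 ≤ d(v,v')`** (the chord between the normalised quaternions is shorter than `|v − v'|`). [folklore] -/
theorem gnDefect_nonneg (v v' : Fin 3 → ℝ) : 0 ≤ gnDefect v v' := by
  rw [gnDefect_eq]
  have hp1 := one_le_norm_gnomonicQuat v
  have hq1 := one_le_norm_gnomonicQuat v'
  have hpq : 1 ≤ ‖gnomonicQuat v‖ * ‖gnomonicQuat v'‖ := by nlinarith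
  have h1 : 0 ≤ 1 - 1 / (‖gnomonicQuat v‖ * ‖gnomonicQuat v'‖) := by
    rw [sub_nonneg, div_le_one (by positivity)]; exact hpq
  have := vsq_nonneg (v - v')
  positivity

/-- `(pq)`-free bounds: `pq ≤ 1 + (|v|²+|v'|²)/2` and `(p−q)² ≤ (|v|² − |v'|²)²/4`. [folklore] -/
theorem norm_mul_norm_gnomonicQuat_le (v v' : Fin 3 → ℝ) :
    ‖gnomonicQuat v‖ * ‖gnomonicQuat v'‖ ≤ 1 + (vsq v + vsq v') / 2 := by
  have hp2 := norm_gnomonicQuat_sq v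
  have hq2 := norm_gnomonicQuat_sq v'
  nlinarith [sq_nonneg (‖gnomonicQuat v‖ - ‖gnomonicQuat v'‖)]

/-- `(p − q)² ≤ (|v|² − |v'|²)²/4` for `p = ‖(1,v)‖`, `q = ‖(1,v')‖` (both `≥ 1`). [folklore] -/
theorem norm_sub_norm_gnomonicQuat_sq_le (v v' : Fin 3 → ℝ) :
    (‖gnomonicQuat v‖ - ‖gnomonicQuat v'‖) ^ 2 ≤ (vsq v - vsq v') ^ 2 / 4 := by
  have hp1 := one_le_norm_gnomonicQuat v
  have hq1 := one_le_norm_gnomonicQuat v'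
  have hp2 := norm_gnomonicQuat_sq v
  have hq2 := norm_gnomonicQuat_sq v'
  -- `(p−q)²(p+q)² = (p²−q²)²` and `(p+q)² ≥ 4`
  have hsum : 4 ≤ (‖gnomonicQuat v‖ + ‖gnomonicQuat v'‖) ^ 2 := by nlinarith
  have hid : (‖gnomonicQuat v‖ - ‖gnomonicQuat v'‖) ^ 2 * (‖gnomonicQuat v‖ + ‖gnomonicQuat v'‖) ^ 2 =
      (vsq v - vsq v') ^ 2 := by
    have : (‖gnomonicQuat v‖ - ‖gnomonicQuat v'‖) * (‖gnomonicQuat v‖ + ‖gnomonicQuat v'‖) =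
        ‖gnomonicQuat v‖ ^ 2 - ‖gnomonicQuat v'‖ ^ 2 := by ring
    rw [← mul_pow, this, hp2, hq2]; ring
  rw [le_div_iff₀ (by norm_num : (0:ℝ) < 4), ← hid]
  exact mul_le_mul_of_nonneg_left hsum (sq_nonneg _)

/-- `(|v|² − |v'|²)² ≤ 2 |v − v'|² (|v|² + |v'|²)` (Cauchy–Schwarz for `⟨v − v', v + v'⟩`). [folklore] -/
theorem vsq_sub_vsq_sq_le (v v' : Fin 3 → ℝ) : (vsq v - vsq v') ^ 2 ≤ 2 * vsq (v - v') * (vsq v + vsq v') := by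
  have hdiff : vsq v - vsq v' = ∑ i, (v i - v' i) * (v i + v' i) := by
    simp only [vsq, ← Finset.sum_sub_distrib]
    exact Finset.sum_congr rfl fun i _ => by ring
  have hcs := Finset.sum_mul_sq_le_sq_mul_sq Finset.univ (fun i => v i - v' i) (fun i => v i + v' i)
  have hplus : ∑ i, (v i + v' i) ^ 2 ≤ 2 * (vsq v + vsq v') := by
    have : 2 * (vsq v + vsq v') - ∑ i, (v i + v' i) ^ 2 = ∑ i, (v i - v' i) ^ 2 := by
      simp only [vsq, Finset.mul_sum, ← Finset.sum_add_distrib, ← Finset.sum_sub_distrib]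
      exact Finset.sum_congr rfl fun i _ => by ring
    linarith [Finset.sum_nonneg fun i (_ : i ∈ (Finset.univ : Finset (Fin 3))) => sq_nonneg (v i - v' i)]
  have hvsq : vsq (v - v') = ∑ i, (v i - v' i) ^ 2 := by simp [vsq]
  rw [hdiff, hvsq]
  calc (∑ i, (v i - v' i) * (v i + v' i)) ^ 2 ≤ (∑ i, (v i - v' i) ^ 2) * ∑ i, (v i + v' i) ^ 2 := hcs
    _ ≤ (∑ i, (v i - v' i) ^ 2) * (2 * (vsq v + vsq v')) :=
        mul_le_mul_of_nonneg_left hplus (Finset.sum_nonneg fun i _ => sq_nonneg _)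
    _ = 2 * (∑ i, (v i - v' i) ^ 2) * (vsq v + vsq v') := by ring

/-- **`d(v,v') ≤ |v − v'|² (|v|² + |v'|²)`**. [folklore] -/
theorem gnDefect_le (v v' : Fin 3 → ℝ) : gnDefect v v' ≤ vsq (v - v') * (vsq v + vsq v') := by
  rw [gnDefect_eq]
  have hp1 := one_le_norm_gnomonicQuat v
  have hq1 := one_le_norm_gnomonicQuat v'
  set P := ‖gnomonicQuat v‖ * ‖gnomonicQuat v'‖ with hP
  have hP1 : 1 ≤ P := by rw [hP]; nlinarith
  have hP0 : 0 < P := by linarith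
  have hD := vsq_nonneg (v - v')
  have hn := vsq_nonneg v
  have hn' := vsq_nonneg v'
  -- term 1: `|v−v'|²(1 − 1/P) ≤ |v−v'|²(P − 1) ≤ |v−v'|²(|v|²+|v'|²)/2`
  have h1 : 1 - 1 / P ≤ (vsq v + vsq v') / 2 := by
    have hle : 1 - 1 / P ≤ P - 1 := by
      rw [show 1 - 1 / P = (P - 1) / P by field_simp]
      exact div_le_self (by linarith) hP1 |>.trans le_rfl
    linarith [norm_mul_norm_gnomonicQuat_le v v']
  -- term 2: `(p−q)²/P ≤ (p−q)² ≤ (|v|²−|v'|²)²/4 ≤ |v−v'|²(|v|²+|v'|²)/2`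
  have h2 : (‖gnomonicQuat v‖ - ‖gnomonicQuat v'‖) ^ 2 / P ≤ vsq (v - v') * (vsq v + vsq v') / 2 := by
    calc (‖gnomonicQuat v‖ - ‖gnomonicQuat v'‖) ^ 2 / P ≤ (‖gnomonicQuat v‖ - ‖gnomonicQuat v'‖) ^ 2 :=
          div_le_self (sq_nonneg _) hP1
      _ ≤ (vsq v - vsq v') ^ 2 / 4 := norm_sub_norm_gnomonicQuat_sq_le v v'
      _ ≤ vsq (v - v') * (vsq v + vsq v') / 2 := by linarith [vsq_sub_vsq_sq_le v v']
  calc vsq (v - v') * (1 - 1 / P) + (‖gnomonicQuat v‖ - ‖gnomonicQuat v'‖) ^ 2 / P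
      ≤ vsq (v - v') * ((vsq v + vsq v') / 2) + vsq (v - v') * (vsq v + vsq v') / 2 :=
        add_le_add (mul_le_mul_of_nonneg_left h1 hD) h2
    _ = vsq (v - v') * (vsq v + vsq v') := by ring

/-! ### §4. Consequences for the link factor -/

/-- `|v − v'|² ≤ 2(|v|² + |v'|²)`. [folklore] -/
theorem vsq_sub_le (v v' : Fin 3 → ℝ) : vsq (v - v') ≤ 2 * (vsq v + vsq v') := by
  have : 2 * (vsq v + vsq v') - vsq (v - v') = ∑ i, (v i + v' i) ^ 2 := by
    simp only [vsq, Finset.mul_sum, ← Finset.sum_add_distrib, ← Finset.sum_sub_distrib, Pi.sub_apply]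
    exact Finset.sum_congr rfl fun i _ => by ring
  linarith [Finset.sum_nonneg fun i (_ : i ∈ (Finset.univ : Finset (Fin 3))) => sq_nonneg (v i + v' i)]

/-- **Opposite hemispheres are far apart**: `Re tr(U W⁻¹) ≤ −2 + 2(|v|² + |v'|²)`. [folklore] -/
theorem re_trace_chart_opposite_le {b b' : Bool} (hbb : b ≠ b') (v v' : Fin 3 → ℝ) :
    (((hemi b * gnoPoint v * (hemi b' * gnoPoint v')⁻¹ : SU2) : Matrix (Fin 2) (Fin 2) ℂ).trace).re ≤
      -2 + 2 * (vsq v + vsq v') := by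
  rw [re_trace_chart_opposite hbb]
  linarith [gnDefect_nonneg v v', vsq_sub_le v v']

/-- **Same hemisphere, lower bound**: `Re tr(U W⁻¹) ≥ 2 − |v − v'|²`. [folklore] -/
theorem two_sub_vsq_le_re_trace_chart_same (b : Bool) (v v' : Fin 3 → ℝ) :
    2 - vsq (v - v') ≤ (((hemi b * gnoPoint v * (hemi b * gnoPoint v')⁻¹ : SU2) : Matrix (Fin 2) (Fin 2) ℂ).trace).re := by
  rw [re_trace_chart_same]
  linarith [gnDefect_nonneg v v']

/-- **Same hemisphere, two-sided**: `|Re tr(U W⁻¹) − (2 − |v−v'|²)| ≤ |v−v'|²(|v|²+|v'|²)`. [folklore] -/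
theorem abs_re_trace_chart_same_sub_le (b : Bool) (v v' : Fin 3 → ℝ) :
    |(((hemi b * gnoPoint v * (hemi b * gnoPoint v')⁻¹ : SU2) : Matrix (Fin 2) (Fin 2) ℂ).trace).re - (2 - vsq (v - v'))| ≤
      vsq (v - v') * (vsq v + vsq v') := by
  rw [re_trace_chart_same, show 2 - vsq (v - v') + gnDefect v v' - (2 - vsq (v - v')) = gnDefect v v' by ring,
    abs_of_nonneg (gnDefect_nonneg v v')]
  exact gnDefect_le v v'

end Summit.QuantumFields.YangMills.Theorems.FemtoTransferGap

end
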